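import Mathlib
import Literature.Computability.AlgebraicComplexity.OrbitClosureEuclidean
import HarnessLib

/-!
# Zariski closure ⊆ classical closure for polynomial images of irreducible affine varieties

Topic `Computability/AlgebraicComplexity` (sibling of `OrbitClosureEuclidean.lean`, whose lemmas
`exists_forall_mem_range_of_aeval_ne_zero` / `mem_closure_range_of_ker_bind₁_le` treat images of
AFFINE SPACE); theorems only. Here the source is an irreducible closed subvariety `V(J) ⊂ K^ι`,
`J` a prime ideal of `K[x_ι]`:

* `exists_forall_mem_image_zeroLocus_of_aeval_ne_zero` — Chevalley: with
  `I = ker (K[y_τ] → K[x_ι] → K[x_ι]/J)` the (prime) ideal of the image of `V(J)` under the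
  polynomial map `Φ_t = P_t`, there is `g ∉ I` such that every zero `z` of `I` with `g(z) ≠ 0` is
  `Φ(x)` for some `x ∈ V(J)(K)` (`K` algebraically closed).
* `mem_closure_image_zeroLocus_of_ker_le` — over `ℂ`: every zero of `I` lies in the classical
  closure of `Φ(V(J)(ℂ))` (density theorem, `mem_closure_setOf_le_ker_aeval`).

The proofs are those of `OrbitClosureEuclidean.lean` with `Spec K[x]` replaced by the irreducible
`Spec (K[x]/J)`. Consumer: orbits of `SL_m(ℂ)³` (an irreducible variety, `V(det - 1)`), in the
valuative proof of the Hilbert–Mumford criterion (item `HilbertMumfordHalf` of route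
MatrixMultiplication/ToricBorderRank): a Euclidean-closed orbit is Zariski closed.

## References

* T. A. Springer, *Linear Algebraic Groups*, 2nd ed. (1998), Thm. 1.9.5 (Chevalley).
  [SpringerLAG1998]
* D. Mumford, *The Red Book of Varieties and Schemes*, I §10 Cor. 1 (complex vs Zariski closure
  of constructible sets). [MumfordRedBook1999]
-/

noncomputable section

open MvPolynomial

namespace Literature.Computability.AlgebraicComplexity

section Chevalley

variable {K : Type*} [Field K] {ι τ : Type*} [Finite ι] [Finite τ]

/-- **Images of irreducible affine varieties contain a dense open subset of their closure**
(Chevalley, Springer 1.9.5, in coordinates): for a prime `J ⊆ K[x_ι]` and a polynomial map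
`Φ_t = P_t`, with `I = ker (K[y_τ] → K[x_ι]/J)`, there is `g ∉ I` such that every zero `z` of `I`
with `g(z) ≠ 0` is the image of a `K`-point of `V(J)` (`K` algebraically closed).
[cite: SpringerLAG1998, Thm 1.9.5] -/
theorem exists_forall_mem_image_zeroLocus_of_aeval_ne_zero [IsAlgClosed K]
    (J : Ideal (MvPolynomial ι K)) [J.IsPrime] (P : τ → MvPolynomial ι K) :
    ∃ g : MvPolynomial τ K,
      g ∉ RingHom.ker (((Ideal.Quotient.mkₐ K J).comp (bind₁ P) :
        MvPolynomial τ K →ₐ[K] MvPolynomial ι K ⧸ J)) ∧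
      ∀ z : τ → K, RingHom.ker (((Ideal.Quotient.mkₐ K J).comp (bind₁ P) :
          MvPolynomial τ K →ₐ[K] MvPolynomial ι K ⧸ J)) ≤
          RingHom.ker (aeval z : MvPolynomial τ K →ₐ[K] K) →
        aeval z g ≠ 0 → ∃ x : ι → K, (∀ q ∈ J, aeval x q = 0) ∧ z = fun t => aeval x (P t) := by
  classical
  haveI : Fintype τ := Fintype.ofFinite τ
  haveI : IsDomain (MvPolynomial ι K ⧸ J) := Ideal.Quotient.isDomain J
  set F : MvPolynomial τ K →ₐ[K] MvPolynomial ι K ⧸ J := (Ideal.Quotient.mkₐ K J).comp (bind₁ P)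
    with hFdef
  set f : MvPolynomial τ K →+* MvPolynomial ι K ⧸ J := F.toRingHom with hfdef
  have hkerf : RingHom.ker f = RingHom.ker F := rfl
  -- `f` is of finite presentation (finite type over a Noetherian source)
  have hfp : f.FinitePresentation := by
    refine RingHom.FinitePresentation.of_finiteType.mp ?_
    refine RingHom.FiniteType.of_comp_finiteType (f := algebraMap K (MvPolynomial τ K)) ?_
    have : f.comp (algebraMap K (MvPolynomial τ K)) = algebraMap K (MvPolynomial ι K ⧸ J) :=
      F.comp_algebraMap
    rw [this]
    exact RingHom.finiteType_algebraMap.mpr inferInstance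
  -- the image of `Spec (K[x]/J) → Spec K[y]` is constructible with irreducible closure `V(ker f)`
  set S : Set (PrimeSpectrum (MvPolynomial τ K)) := Set.range (PrimeSpectrum.comap f) with hSdef
  have hScons : Topology.IsConstructible S := by
    have h := PrimeSpectrum.isConstructible_comap_image hfp Topology.IsConstructible.univ
    rwa [Set.image_univ] at h
  have hclS : closure S = PrimeSpectrum.zeroLocus (RingHom.ker f) :=
    PrimeSpectrum.closure_range_comap f
  have hirr : IsIrreducible (closure S) := by
    refine IsIrreducible.closure ?_
    rw [hSdef, ← Set.image_univ]
    exact (IrreducibleSpace.isIrreducible_univ _).image _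
      (PrimeSpectrum.continuous_comap f).continuousOn
  obtain ⟨O, hO, ⟨p, hpO, hpcl⟩, hOS⟩ :=
    Literature.NumberTheory.Automorphic.exists_isOpen_inter_closure_subset_of_isConstructible
      hScons hirr
  obtain ⟨_, ⟨g, rfl⟩, hpg, hgO⟩ :=
    PrimeSpectrum.isTopologicalBasis_basic_opens.exists_subset_of_mem_open hpO hO
  refine ⟨g, ?_, ?_⟩
  · intro hg
    rw [hclS, PrimeSpectrum.mem_zeroLocus, SetLike.coe_subset_coe] at hpcl
    exact (PrimeSpectrum.mem_basicOpen g p).mp hpg (hpcl (hkerf ▸ hg))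
  · intro z hz hgz
    haveI hprime : (RingHom.ker (aeval z : MvPolynomial τ K →ₐ[K] K)).IsPrime :=
      RingHom.ker_isPrime _
    set mz : PrimeSpectrum (MvPolynomial τ K) :=
      ⟨RingHom.ker (aeval z : MvPolynomial τ K →ₐ[K] K), hprime⟩ with hmzdef
    have hmzS : mz ∈ S := by
      refine hOS ⟨hgO ?_, ?_⟩
      · show mz ∈ (PrimeSpectrum.basicOpen g : Set (PrimeSpectrum (MvPolynomial τ K)))
        rw [SetLike.mem_coe, PrimeSpectrum.mem_basicOpen]
        simpa [hmzdef, RingHom.mem_ker] using hgz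
      · rw [hclS, PrimeSpectrum.mem_zeroLocus, SetLike.coe_subset_coe, hkerf]
        exact hz
    obtain ⟨Q, hQ⟩ := hmzS
    -- a closed point above `Q`: a maximal ideal `n` of `K[x]/J`, i.e. `𝔪_x ⊇ J` of `K[x]`
    obtain ⟨n, hnmax, hQn⟩ := Ideal.exists_le_maximal Q.asIdeal Q.isPrime.ne_top
    set n' : Ideal (MvPolynomial ι K) := n.comap (Ideal.Quotient.mk J) with hn'def
    have hn'max : n'.IsMaximal := Ideal.comap_isMaximal_of_surjective _ Ideal.Quotient.mk_surjective
    obtain ⟨x, hnx⟩ := (MvPolynomial.isMaximal_iff_eq_vanishingIdeal_singleton (I := n')).mp hn'max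
    have hJx : ∀ q ∈ J, aeval x q = 0 := by
      intro q hq
      have : q ∈ n' := by
        rw [hn'def, Ideal.mem_comap, Ideal.Quotient.eq_zero_iff_mem.mpr hq]
        exact n.zero_mem
      rw [hnx, MvPolynomial.mem_vanishingIdeal_iff] at this
      exact this x rfl
    refine ⟨x, hJx, funext fun t => ?_⟩
    -- `f⁻¹(n) = 𝔪_z`
    have hmax : (RingHom.ker (aeval z : MvPolynomial τ K →ₐ[K] K)).IsMaximal :=
      RingHom.ker_isMaximal_of_surjective (aeval z : MvPolynomial τ K →ₐ[K] K)
        fun c => ⟨C c, by simp⟩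
    have hle : RingHom.ker (aeval z : MvPolynomial τ K →ₐ[K] K) ≤ n.comap f := by
      intro q hq
      have h1 : q ∈ (PrimeSpectrum.comap f Q).asIdeal := by rw [hQ]; exact hq
      rw [PrimeSpectrum.comap_asIdeal] at h1
      exact Ideal.comap_mono hQn h1
    have heq : n.comap f = RingHom.ker (aeval z : MvPolynomial τ K →ₐ[K] K) :=
      (hmax.eq_of_le (Ideal.comap_ne_top f hnmax.ne_top) hle).symm
    have hmem : X t - C (z t) ∈ RingHom.ker (aeval z : MvPolynomial τ K →ₐ[K] K) := by
      rw [RingHom.mem_ker, map_sub, aeval_X, aeval_C]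
      exact sub_self _
    rw [← heq, Ideal.mem_comap] at hmem
    -- `f (y_t - z_t) = mk (P_t - z_t)`
    have hf : f (X t - C (z t)) = Ideal.Quotient.mk J (P t - C (z t)) := by
      rw [hfdef, hFdef]
      simp [bind₁_X_right]
    rw [hf] at hmem
    have hmem' : P t - C (z t) ∈ n' := by rw [hn'def, Ideal.mem_comap]; exact hmem
    rw [hnx, MvPolynomial.mem_vanishingIdeal_iff] at hmem'
    have h2 := hmem' x rfl
    rw [map_sub, aeval_C] at h2
    exact (sub_eq_zero.mp h2).symm

end Chevalley

section ComplexImage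

variable {ι τ : Type*} [Finite ι] [Finite τ]

/-- **Zariski closure ⊆ classical closure for images of irreducible affine varieties over `ℂ`.**
For a prime `J ⊆ ℂ[x_ι]` and a polynomial map `Φ_t = P_t`, every common zero `z` of the
polynomials whose pull-back to `ℂ[x]/J` vanishes (`ker ≤ 𝔪_z`) lies in the classical closure of
`Φ(V(J)(ℂ))`. Mumford, Red Book I §10 (constructible sets); Landsberg 2017 Thm. 3.1.6.1.
[cite: MumfordRedBook1999, I §10 Cor. 1] -/
theorem mem_closure_image_zeroLocus_of_ker_le (J : Ideal (MvPolynomial ι ℂ)) [J.IsPrime]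
    (P : τ → MvPolynomial ι ℂ) {z : τ → ℂ}
    (hz : RingHom.ker (((Ideal.Quotient.mkₐ ℂ J).comp (bind₁ P) :
        MvPolynomial τ ℂ →ₐ[ℂ] MvPolynomial ι ℂ ⧸ J)) ≤
      RingHom.ker (aeval z : MvPolynomial τ ℂ →ₐ[ℂ] ℂ)) :
    z ∈ closure ((fun (x : ι → ℂ) (t : τ) => aeval x (P t)) '' {x | ∀ q ∈ J, aeval x q = 0}) := by
  obtain ⟨g, hg, hrange⟩ := exists_forall_mem_image_zeroLocus_of_aeval_ne_zero J P
  haveI : IsDomain (MvPolynomial ι ℂ ⧸ J) := Ideal.Quotient.isDomain J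
  haveI : (RingHom.ker (((Ideal.Quotient.mkₐ ℂ J).comp (bind₁ P) :
      MvPolynomial τ ℂ →ₐ[ℂ] MvPolynomial ι ℂ ⧸ J))).IsPrime := RingHom.ker_isPrime _
  have h := Literature.NumberTheory.Transcendental.AlgHomClosure.mem_closure_setOf_le_ker_aeval
    (k := ℂ) (p := RingHom.ker (((Ideal.Quotient.mkₐ ℂ J).comp (bind₁ P) :
      MvPolynomial τ ℂ →ₐ[ℂ] MvPolynomial ι ℂ ⧸ J))) hg hz
  refine closure_mono (fun w hw => ?_) h
  obtain ⟨x, hx, rfl⟩ := hrange w hw.1 hw.2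
  exact ⟨x, hx, rfl⟩

end ComplexImage

end Literature.Computability.AlgebraicComplexity
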